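import Summits.HodgeConjecture.HodgeConjecture.Theses.PadicSemiregularLift
import Summits.HodgeConjecture.HodgeConjecture.Theorems.PadicSemiregularLiftPadicPridhamSemiregularityPadicTowerSections
import Summits.HodgeConjecture.HodgeConjecture.Theorems.PadicSemiregularLiftFormalVectorBundlesAlgebraizePullbackUnitSections
import Summits.HodgeConjecture.HodgeConjecture.Theorems.PadicSemiregularLiftFormalVectorBundlesAlgebraizeKernelVectorBundle
import Summits.HodgeConjecture.HodgeConjecture.Theorems.PadicSemiregularLiftFormalVectorBundlesAlgebraizeLadderCore
import Summits.HodgeConjecture.HodgeConjecture.Theorems.PadicSemiregularLiftFormalVectorBundlesAlgebraizeThickenings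

/-!
# The `p`-adic ladder of a vector bundle on a thickening of a `W`-flat scheme (support for EB1)

Support lemmas for stub EB1 (`stub_towerPresentation`) of line `chow-zariski-pushforward` of the crux
`FormalVectorBundlesAlgebraize` (route `PadicSemiregularLift` of `HodgeConjecture`).

For `k` perfect of characteristic `p`, `W = W(k)`, a `W`-FLAT `W`-scheme `Z` with thickenings
`Z_m = Z ⊗_W W/p^m`, the transition closed immersions `t : Z_{n+1} ⟶ Z_{n + 1 + 1}`, `t' : Z_1 ⟶ Z_{n + 1 + 1}`,
`ι_m : Z_m ⟶ Z`, and a finite locally free `N` on `Z_{n + 1 + 1}`: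

* `tower_ladderCore`: the units `η_t : N ⟶ t_* t^* N` and `η_{t'} : N ⟶ t'_* t'^* N` satisfy the
  hypotheses of the abstract ladder `ladderCore` with `a = p^{n+1}`, `b = p` (kernels from
  `…PullbackUnitSections` and `ker t♯ = (p^{n+1})`, `ker t'♯ = (p)`, tree `ker_app_thickeningMap_le`;
  flatness `p^{n+1} x = 0 ⟹ x ∈ pN` on the frames of `N` from the `W`-flatness of `Z`,
  tree `mem_span_of_mul_eq_zero_of_flat`; `p^{n + 1 + 1} = 0` on `Z_{n + 1 + 1}`);
* `tower_ladder`: consequently, for an isomorphism `s : t^* N ≅ F` the transition map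
  `g = ι_{n + 1 + 1,*}(η_t ≫ t_* s) ≫ (ι_{n + 1 + 1,*} t_* ≅ ι_{n+1,*}) : ι_{n + 1 + 1,*} N ⟶ ι_{n+1,*} F` of `Z`-modules is
  surjective with kernel `p^{n+1}·` on the small affine opens of `Z`, and sits in a short exact
  sequence `0 → ι_{n + 1 + 1,*} t'_* t'^* N → ι_{n + 1 + 1,*} N → ι_{n+1,*} F → 0` whose kernel is
  `ι_{1,*}(t'^* N)` up to the canonical isomorphism.

Everything is proved; no definitions.
-/

noncomputable section

-- Summit.HodgeConjecture.HodgeConjecture.… repeats the summit name by the D-0017 layout (Sub = Summit).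
set_option linter.dupNamespace false
-- `TopCat.Presheaf`, `Scheme.Modules` and `(𝟭 _).obj` are not reducible (as in Mathlib's
-- `AlgebraicGeometry/Modules`).
set_option backward.isDefEq.respectTransparency false

open CategoryTheory CategoryTheory.Limits AlgebraicGeometry TopologicalSpace Opposite
open Literature.AlgebraicGeometry.Motives Literature.AlgebraicGeometry.Motives.WittScheme
open Literature.AlgebraicGeometry.Modules
open Summit.HodgeConjecture.HodgeConjecture.Theorems.PadicPridhamSemiregularity

universe u

namespace Summit.HodgeConjecture.HodgeConjecture.Theorems.FormalVectorBundlesAlgebraize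

/-! ### Module-theoretic bookkeeping -/

section Algebra

variable {R M : Type*} [CommRing R] [AddCommGroup M] [Module R M]

/-- `x ∈ ker f · M` iff `x` is a multiple of `c` when `ker f = (c)`. -/
theorem mem_ker_smul_top_iff {S : Type*} [Semiring S] (f : R →+* S) (c : R)
    (hle : RingHom.ker f ≤ Ideal.span {c}) (hc : f c = 0) (x : M) :
    x ∈ RingHom.ker f • (⊤ : Submodule R M) ↔ ∃ x' : M, x = c • x' := by
  have hK : RingHom.ker f = Ideal.span {c} :=
    le_antisymm hle ((Ideal.span_singleton_le_iff_mem _).mpr hc)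
  rw [hK, Submodule.ideal_span_singleton_smul, Submodule.mem_smul_pointwise_iff_exists]
  exact ⟨fun ⟨y, _, hy⟩ => ⟨y, hy.symm⟩, fun ⟨y, hy⟩ => ⟨y, Submodule.mem_top, hy.symm⟩⟩

/-- **Flatness on a free module**: if `a y = 0 ⟹ y ∈ (b)` in `R`, then `a x = 0 ⟹ x ∈ bM` for `M`
free (coordinatewise). -/
theorem exists_eq_smul_of_smul_eq_zero_of_basis {ι : Type*} [Fintype ι] (bs : Module.Basis ι R M)
    (a b : R) (hR : ∀ y : R, a * y = 0 → y ∈ Ideal.span {b}) (x : M) (hx : a • x = 0) :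
    ∃ x' : M, x = b • x' := by
  classical
  have hcoord : ∀ i, ∃ c : R, bs.repr x i = b * c := by
    intro i
    have h0 : a * bs.repr x i = 0 := by
      have := congrArg (fun m => bs.repr m i) hx
      simpa only [map_smul, Finsupp.smul_apply, smul_eq_mul, map_zero, Finsupp.zero_apply] using this
    obtain ⟨c, hc⟩ := Ideal.mem_span_singleton'.mp (hR _ h0)
    exact ⟨c, by rw [← hc, mul_comm]⟩
  choose c hc using hcoord
  refine ⟨∑ i, c i • bs i, ?_⟩
  conv_lhs => rw [← bs.sum_repr x]
  rw [Finset.smul_sum]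
  refine Finset.sum_congr rfl fun i _ => ?_
  rw [hc i, mul_smul]

end Algebra

/-! ### The `p`-adic tower: closed immersions and flatness -/

section Tower

variable {p : ℕ} [Fact p.Prime] {k : Type u} [Field k] (Z : SchemeOver (WittVector p k))
  [CharP k p] [PerfectRing k p]

/-- **Flatness input** for a `W`-FLAT `Z` (the tree's `mem_span_p_of_pow_mul_eq_zero_thickening` assumes
smoothness instead): on an affine open `U ⊆ Z_{n + 1 + 1}`, `p^{n+1} b = 0 ⟹ b ∈ (p)`. -/
theorem mem_span_p_of_pow_mul_eq_zero_of_flat [Flat Z.hom] (n : ℕ)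
    {U : (thickening Z (n + 1 + 1)).left.Opens} (hU : IsAffineOpen U) (b : Γ((thickening Z (n + 1 + 1)).left, U))
    (hb : ((p ^ (n + 1) : ℕ) : Γ((thickening Z (n + 1 + 1)).left, U)) * b = 0) :
    b ∈ Ideal.span {((p ^ 1 : ℕ) : Γ((thickening Z (n + 1 + 1)).left, U))} := by
  haveI : Flat (thickening Z (n + 1 + 1)).hom :=
    inferInstanceAs (Flat (pullback.snd Z.hom (Spec.map _)))
  have hf := flat_appLE_comp_ΓSpecIso_inv (thickening Z (n + 1 + 1)).hom hU
  have hxy : ((p ^ (n + 1) : ℕ) : wittQuot p k (n + 1 + 1)) * ((p ^ 1 : ℕ) :) = 0 := by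
    rw [← Nat.cast_mul, ← pow_add]
    exact natCast_pow_eq_zero_wittQuot (n + 1 + 1)
  have h := mem_span_of_mul_eq_zero_of_flat hf hxy (mem_span_p_of_pow_mul_eq_zero n)
    (a := b) (by rwa [map_natCast])
  rwa [map_natCast] at h

end Tower

/-! ### The hypotheses of the abstract ladder for the units of `t` and `t'` -/

section LadderHypotheses

variable {p : ℕ} [Fact p.Prime] {k : Type u} [Field k] [CharP k p] [PerfectRing k p]
  (Z : SchemeOver (WittVector p k)) [Flat Z.hom] (n : ℕ)

omit [CharP k p] [PerfectRing k p] [Flat Z.hom] in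
/-- Shorthand-free statement of the kernel of the unit on small affines: for the transition map
`t : Z_m ⟶ Z_{m'}` of the tower and `N` finite locally free on `Z_{m'}`, near every point,
`η_N x = 0 ↔ x = p^m x'` and `η_N` is surjective on affine opens. -/
theorem unit_thickeningMap_local {m m' : ℕ} (h : m ≤ m') (N : (thickening Z m').left.Modules)
    (hN : IsFiniteLocallyFree N) (y : (thickening Z m').left) :
    ∃ U : (thickening Z m').left.Opens, y ∈ U ∧ ∀ V : (thickening Z m').left.Opens, IsAffineOpen V →
      V ≤ U →
      Function.Surjective (((Scheme.Modules.pullbackPushforwardAdjunction (thickeningMap Z h)).unit.app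
        N).app V) ∧
      ∀ x : Γ(N, V), ((Scheme.Modules.pullbackPushforwardAdjunction (thickeningMap Z h)).unit.app
        N).app V x = 0 ↔ ∃ x' : Γ(N, V), x = (p ^ m) • x' := by
  haveI := isClosedImmersion_thickeningMap Z h
  obtain ⟨U, hyU, hU⟩ := exists_nhds_unit_app_surjective_and_ker (thickeningMap Z h) hN y
  refine ⟨U, hyU, fun V hV hVU => ⟨(hU V hV hVU).1, fun x => ?_⟩⟩
  rw [(hU V hV hVU).2 x, mem_ker_smul_top_iff _ ((p ^ m : ℕ) : Γ((thickening Z m').left, V))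
    (ker_app_thickeningMap_le Z h hV) (by
      change (thickeningMap Z h).app V _ = 0
      rw [map_natCast]; exact natCast_pow_eq_zero_thickening Z m _)]
  simp only [Nat.cast_smul_eq_nsmul]

/-- **The units of `t : Z_{n+1} ⟶ Z_{n + 1 + 1}` and `t' : Z_1 ⟶ Z_{n + 1 + 1}` at a finite locally free `N` satisfy
the hypotheses of `ladderCore`** with `a = p^{n+1}`, `b = p`. -/
theorem tower_ladder_hypotheses (h12 : n + 1 ≤ n + 1 + 1) (h₁ : 1 ≤ n + 1 + 1) (N : (thickening Z (n + 1 + 1)).left.Modules)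
    (hN : IsFiniteLocallyFree N) (y : (thickening Z (n + 1 + 1)).left) :
    ∃ U : (thickening Z (n + 1 + 1)).left.Opens, y ∈ U ∧ ∀ V : (thickening Z (n + 1 + 1)).left.Opens,
      IsAffineOpen V → V ≤ U →
      Function.Surjective (((Scheme.Modules.pullbackPushforwardAdjunction
        (thickeningMap Z h12)).unit.app N).app V) ∧
      (∀ x : Γ(N, V), ((Scheme.Modules.pullbackPushforwardAdjunction
        (thickeningMap Z h12)).unit.app N).app V x = 0 ↔
          ∃ x', x = (p ^ (n + 1)) • x') ∧
      Function.Surjective (((Scheme.Modules.pullbackPushforwardAdjunction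
        (thickeningMap Z h₁)).unit.app N).app V) ∧
      (∀ x : Γ(N, V), ((Scheme.Modules.pullbackPushforwardAdjunction
        (thickeningMap Z h₁)).unit.app N).app V x = 0 ↔ ∃ x', x = p • x') ∧
      (∀ x : Γ(N, V), (p ^ (n + 1)) • x = 0 → ∃ x', x = p • x') ∧
      (∀ x : Γ(N, V), (p ^ (n + 1) * p) • x = 0) := by
  classical
  obtain ⟨U₁, hy₁, hU₁⟩ := unit_thickeningMap_local Z h12 N hN y
  obtain ⟨U₂, hy₂, hU₂⟩ := unit_thickeningMap_local Z h₁ N hN y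
  obtain ⟨U₃, hy₃, I, hI, ⟨e⟩⟩ := hN y
  haveI := Fintype.ofFinite I
  refine ⟨U₁ ⊓ U₂ ⊓ U₃, ⟨⟨hy₁, hy₂⟩, hy₃⟩, fun V hV hVU => ?_⟩
  have hV₁ : V ≤ U₁ := hVU.trans (inf_le_left.trans inf_le_left)
  have hV₂ : V ≤ U₂ := hVU.trans (inf_le_left.trans inf_le_right)
  have hV₃ : V ≤ U₃ := hVU.trans inf_le_right
  refine ⟨(hU₁ V hV hV₁).1, (hU₁ V hV hV₁).2, (hU₂ V hV hV₂).1, ?_, ?_, ?_⟩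
  · intro x
    rw [(hU₂ V hV hV₂).2 x]
    simp only [pow_one]
  · -- flatness, on the frame of `N` over `V`
    intro x hx
    obtain ⟨bs⟩ := nonempty_basis_of_frame
      (SheafOfModules.restrictTrivialisation (R := (thickening Z (n + 1 + 1)).left.ringCatSheaf) (homOfLE hV₃) e)
    have hx' : ((p ^ (n + 1) : ℕ) : Γ((thickening Z (n + 1 + 1)).left, V)) • x = 0 := by
      rw [Nat.cast_smul_eq_nsmul]; exact hx
    obtain ⟨x', hx'⟩ := exists_eq_smul_of_smul_eq_zero_of_basis bs _ _
      (fun b hb => by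
        have := mem_span_p_of_pow_mul_eq_zero_of_flat Z n hV b hb
        rwa [pow_one] at this) x hx'
    exact ⟨x', by rw [hx', Nat.cast_smul_eq_nsmul]⟩
  · intro x
    rw [← pow_succ, ← Nat.cast_smul_eq_nsmul (R := Γ((thickening Z (n + 1 + 1)).left, V)),
      natCast_pow_eq_zero_thickening Z (n + 1 + 1) V, zero_smul]

end LadderHypotheses

/-! ### The ladder pushed forward along a closed immersion (abstract schemes) -/

section Abstract

variable {X₁ Y Z' : Scheme.{u}} (t : X₁ ⟶ Y) (ι₂ : Y ⟶ Z') (ι₁ : X₁ ⟶ Z') (hι : t ≫ ι₂ = ι₁)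
  [IsClosedImmersion ι₂] {N R : Y.Modules} {F : X₁.Modules}
  (s : (Scheme.Modules.pullback t).obj N ≅ F) (ρ : N ⟶ R) (a b : ℕ)

include hι in
/-- **The ladder, pushed forward** (abstract form; the schemes are variables so that the kernel never
unfolds the fibre products of the `p`-adic tower). Given the hypotheses of `ladderCore` for the unit
`η_t : N ⟶ t_* t^* N` and `ρ`, and an isomorphism `s : t^* N ≅ F`, the map
`g = ι₂_*(η_t ≫ t_* s) ≫ (ι₂_* t_* F ≅ ι₁_* F)` is, near every point of `Z'`, surjective with kernel
`a·` on affine opens, and `0 → ι₂_* R → ι₂_* N —g→ ι₁_* F → 0` is short exact. -/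
theorem ladder_pushforward
    (hloc : ∀ y : Y, ∃ U : Y.Opens, y ∈ U ∧ ∀ V : Y.Opens, IsAffineOpen V → V ≤ U →
      Function.Surjective (((Scheme.Modules.pullbackPushforwardAdjunction t).unit.app N).app V) ∧
      (∀ x : Γ(N, V), ((Scheme.Modules.pullbackPushforwardAdjunction t).unit.app N).app V x = 0 ↔
        ∃ x', x = a • x') ∧
      Function.Surjective (ρ.app V) ∧ (∀ x : Γ(N, V), ρ.app V x = 0 ↔ ∃ x', x = b • x') ∧
      (∀ x : Γ(N, V), a • x = 0 → ∃ x', x = b • x') ∧ (∀ x : Γ(N, V), (a * b) • x = 0))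
    (g : (Scheme.Modules.pushforward ι₂).obj N ⟶ (Scheme.Modules.pushforward ι₁).obj F)
    (hg : g = (Scheme.Modules.pushforward ι₂).map
        ((Scheme.Modules.pullbackPushforwardAdjunction t).unit.app N ≫
          (Scheme.Modules.pushforward t).map s.hom) ≫
        (Scheme.Modules.pushforwardComp t ι₂).hom.app F ≫ (Scheme.Modules.pushforwardCongr hι).hom.app F) :
    (∀ z : Z', ∃ U' : Z'.Opens, z ∈ U' ∧ ∀ W : Z'.Opens, IsAffineOpen W → W ≤ U' →
      Function.Surjective (g.app W) ∧ ∀ x, g.app W x = 0 ↔ ∃ x', x = a • x') ∧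
    ∃ (j : (Scheme.Modules.pushforward ι₂).obj R ⟶ (Scheme.Modules.pushforward ι₂).obj N)
      (w : j ≫ g = 0), (ShortComplex.mk j g w).ShortExact := by
  -- the two reductions `φ = η_t ≫ t_* s`, `ρ` and the abstract ladder
  let φ : N ⟶ (Scheme.Modules.pushforward t).obj F :=
    (Scheme.Modules.pullbackPushforwardAdjunction t).unit.app N ≫ (Scheme.Modules.pushforward t).map s.hom
  have hloc' : ∀ y : Y, ∃ U : Y.Opens, y ∈ U ∧ ∀ V : Y.Opens, IsAffineOpen V → V ≤ U →
      Function.Surjective (φ.app V) ∧ (∀ x : Γ(N, V), φ.app V x = 0 ↔ ∃ x', x = a • x') ∧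
      Function.Surjective (ρ.app V) ∧ (∀ x : Γ(N, V), ρ.app V x = 0 ↔ ∃ x', x = b • x') ∧
      (∀ x : Γ(N, V), a • x = 0 → ∃ x', x = b • x') ∧ (∀ x : Γ(N, V), (a * b) • x = 0) := by
    intro y
    obtain ⟨U, hyU, hU⟩ := hloc y
    refine ⟨U, hyU, fun V hV hVU => ?_⟩
    obtain ⟨h1, h2, h3, h4, h5, h6⟩ := hU V hV hVU
    have hbij : Function.Bijective (((Scheme.Modules.pushforward t).map s.hom).app V) :=
      ConcreteCategory.bijective_of_isIso _
    have hφapp : ∀ x, φ.app V x = ((Scheme.Modules.pushforward t).map s.hom).app V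
        (((Scheme.Modules.pullbackPushforwardAdjunction t).unit.app N).app V x) := fun x => by
      simp only [φ, Scheme.Modules.Hom.comp_app]
      rfl
    refine ⟨fun y => ?_, fun x => ?_, h3, h4, h5, h6⟩
    · obtain ⟨y', rfl⟩ := hbij.2 y
      obtain ⟨x, rfl⟩ := h1 y'
      exact ⟨x, hφapp x⟩
    · rw [← h2 x, hφapp, ← (((Scheme.Modules.pushforward t).map s.hom).app V).hom.map_zero]
      exact hbij.1.eq_iff
  obtain ⟨hφ, ν, hν, hνeq⟩ := ladderCore φ ρ a b hloc'
  haveI := hν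
  haveI : Epi ((Scheme.Modules.pushforward ι₂).map φ) :=
    epi_pushforward_map_of_locally_surjective φ ι₂ fun y => by
      obtain ⟨U, hyU, hU⟩ := hloc' y
      exact ⟨U, hyU, fun V hV hVU => (hU V hV hVU).1⟩
  have hSE := shortExact_pushforward_of_isIso φ ι₂ ν
  -- `g = ι₂_* φ ≫ (iso)`
  let ex : (Scheme.Modules.pushforward ι₂).obj ((Scheme.Modules.pushforward t).obj F) ≅
      (Scheme.Modules.pushforward ι₁).obj F :=
    (Scheme.Modules.pushforwardComp t ι₂).app F ≪≫ (Scheme.Modules.pushforwardCongr hι).app F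
  have hg' : g = (Scheme.Modules.pushforward ι₂).map φ ≫ ex.hom := by
    rw [hg]
    simp only [ex, φ, Iso.trans_hom, Iso.app_hom]
  refine ⟨fun z => ?_, ?_⟩
  · -- local surjectivity and kernel of `g`, transferred from `φ` along `ι₂`
    haveI := subsingleton_sections_bot ((Scheme.Modules.pushforward t).obj F)
    haveI := subsingleton_sections_bot N
    obtain ⟨U', hzU', hU'⟩ := exists_nhds_preimage_of_isClosedImmersion ι₂
      (fun V => Function.Surjective (φ.app V) ∧
        ∀ x : Γ(N, V), φ.app V x = 0 ↔ ∃ x', x = a • x')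
      ⟨fun y => ⟨0, Subsingleton.elim _ _⟩, fun x =>
        ⟨fun _ => ⟨x, Subsingleton.elim _ _⟩, fun _ => Subsingleton.elim _ _⟩⟩
      (fun y => by
        obtain ⟨U, hyU, hU⟩ := hloc' y
        exact ⟨U, hyU, fun V hV hVU => ⟨(hU V hV hVU).1, (hU V hV hVU).2.1⟩⟩) z
    refine ⟨U', hzU', fun W hW hWU' => ?_⟩
    obtain ⟨hs, hk⟩ := hU' W hW hWU'
    have hbij : Function.Bijective ((ex.hom).app W) := ConcreteCategory.bijective_of_isIso _
    have happ : ∀ x, g.app W x = ex.hom.app W (φ.app (ι₂ ⁻¹ᵁ W) x) := fun x => by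
      rw [hg', Scheme.Modules.Hom.comp_app, Scheme.Modules.pushforward_map_app]
      rfl
    refine ⟨fun y => ?_, fun x => ⟨fun h => (hk x).mp (hbij.1 ?_), fun h => ?_⟩⟩
    · obtain ⟨y', rfl⟩ := hbij.2 y
      obtain ⟨x, rfl⟩ := hs y'
      exact ⟨x, happ x⟩
    · rw [map_zero, ← happ, h]
    · rw [happ, (hk x).mpr h, map_zero]
  · -- the short exact sequence, transported along `ex` on the third object
    have w : (Scheme.Modules.pushforward ι₂).map (ν ≫ kernel.ι φ) ≫ g = 0 := by
      rw [hg', ← Category.assoc, ← Functor.map_comp, Category.assoc, kernel.condition, comp_zero,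
        Functor.map_zero, zero_comp]
    refine ⟨(Scheme.Modules.pushforward ι₂).map (ν ≫ kernel.ι φ), w, ?_⟩
    refine ShortComplex.shortExact_of_iso ?_ hSE
    exact ShortComplex.isoMk (Iso.refl _) (Iso.refl _) ex (by simp) (by
      change 𝟙 _ ≫ g = (Scheme.Modules.pushforward ι₂).map φ ≫ ex.hom
      rw [Category.id_comp, hg'])

end Abstract

/-! ### The ladder on `Z` -/

section LadderOnZ

variable {p : ℕ} [Fact p.Prime] {k : Type u} [Field k] [CharP k p] [PerfectRing k p]
  (Z : SchemeOver (WittVector p k)) [Flat Z.hom] (n : ℕ)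

/-- **The `p`-adic ladder of a finite locally free `N` on `Z_{n+2}`, on `Z`** (`ladder_pushforward`
for `t : Z_{n+1} ⟶ Z_{n+2}`, `ι_m : Z_m ⟶ Z`, `ρ = η_{t'}`, `t' : Z_1 ⟶ Z_{n+2}`, `a = p^{n+1}`,
`b = p`): for `s : t^* N ≅ F`, the transition map `g = ι_{n+2,*}(η_t ≫ t_* s) ≫ (≅)` is surjective with
kernel `p^{n+1}·` on the small affine opens of `Z`, and
`0 → ι_{n+2,*} t'_* t'^* N → ι_{n+2,*} N —g→ ι_{n+1,*} F → 0` is short exact. -/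
theorem tower_ladder (h12 : n + 1 ≤ n + 1 + 1) (h₁ : 1 ≤ n + 1 + 1)
    (N : (thickening Z (n + 1 + 1)).left.Modules) (hN : IsFiniteLocallyFree N)
    (F : (thickening Z (n + 1)).left.Modules)
    (s : (Scheme.Modules.pullback (thickeningMap Z h12)).obj N ≅ F)
    (g : (Scheme.Modules.pushforward (thickeningι Z (n + 1 + 1))).obj N ⟶
      (Scheme.Modules.pushforward (thickeningι Z (n + 1))).obj F)
    (hg : g = (Scheme.Modules.pushforward (thickeningι Z (n + 1 + 1))).map
        ((Scheme.Modules.pullbackPushforwardAdjunction (thickeningMap Z h12)).unit.app N ≫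
          (Scheme.Modules.pushforward (thickeningMap Z h12)).map s.hom) ≫
        (Scheme.Modules.pushforwardComp (thickeningMap Z h12) (thickeningι Z (n + 1 + 1))).hom.app F ≫
        (Scheme.Modules.pushforwardCongr (thickeningMap_ι Z h12)).hom.app F) :
    (∀ z : Z.left, ∃ U' : Z.left.Opens, z ∈ U' ∧ ∀ W : Z.left.Opens, IsAffineOpen W → W ≤ U' →
      Function.Surjective (g.app W) ∧ ∀ x, g.app W x = 0 ↔ ∃ x', x = (p ^ (n + 1)) • x') ∧
    ∃ (j : (Scheme.Modules.pushforward (thickeningι Z (n + 1 + 1))).obj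
        ((Scheme.Modules.pushforward (thickeningMap Z h₁)).obj
          ((Scheme.Modules.pullback (thickeningMap Z h₁)).obj N)) ⟶
        (Scheme.Modules.pushforward (thickeningι Z (n + 1 + 1))).obj N) (w : j ≫ g = 0),
      (ShortComplex.mk j g w).ShortExact :=
  haveI := isClosedImmersion_thickeningι Z (n + 1 + 1)
  ladder_pushforward (thickeningMap Z h12) (thickeningι Z (n + 1 + 1)) (thickeningι Z (n + 1))
    (thickeningMap_ι Z h12) s ((Scheme.Modules.pullbackPushforwardAdjunction (thickeningMap Z h₁)).unit.app N)
    (p ^ (n + 1)) p (tower_ladder_hypotheses Z n h12 h₁ N hN) g hg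

end LadderOnZ

/-- **Registered sub-goal** (helper stub of `stub_towerPresentation`, universe `0`): `Z_m ⟶ Z` is a closed
immersion (sibling file `…Thickenings`, `isClosedImmersion_thickeningι`). -/
theorem stub_thickeningIotaClosedImmersion :
    ∀ (p : ℕ) [Fact p.Prime] (k : Type) [Field k]
      (Z : Literature.AlgebraicGeometry.Motives.SchemeOver (WittVector p k)) (m : ℕ),
      AlgebraicGeometry.IsClosedImmersion
        (Literature.AlgebraicGeometry.Motives.WittScheme.thickeningι Z m) :=
  fun _ _ _ _ Z m => isClosedImmersion_thickeningι Z m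

end Summit.HodgeConjecture.HodgeConjecture.Theorems.FormalVectorBundlesAlgebraize

end
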